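import Mathlib
import Summits.NavierStokesRegularity.NavierStokesRegularity.Theorems.SubOnsagerCeilingKPDeadEndPumpStarvation
import Summits.NavierStokesRegularity.NavierStokesRegularity.Theorems.SubOnsagerCeilingKPBarrierCurrency
import Summits.NavierStokesRegularity.NavierStokesRegularity.Theorems.SubcriticalEnvelopeForwardSourceTailEnvelopeKPDyadicRatioTwo
import HarnessLib

/-!
# The ν-uniform shell barrier of the DEAD-END PUMP CLASS at every scale ratio (energy starvation, part 2 of 2)
# (helper file for the crux `SubOnsagerCeiling.ForwardTailCeilingKP`, stmt-NavierStokesRegularity-27057, `--supports`)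

Sequel of `Theorems/SubOnsagerCeilingKPDeadEndPumpStarvation.lean` (the class: Katz–Pavlović chain `c₀` on component
`0` + in-shell diagonal pump `P` into the dead-end component `1`; the mechanism: geometric starvation of the bond
fluxes `Φ_{k+1} ≤ Φ_k/(1 + P²/c₀²)`).  Here the starved fluxes and the class-wide band bound
`Σ_i ½X_{i,k}(t)² ≤ Φ_k(t)` (`kpProper_bandEnergy_le_gateFlux`) give:

* `deadEndPump_shellBarrierAt` — `ShellBarrierAt R ε₀ α` with `(1+ε₀)^{2θ} = 1 + P²/c₀²`
  (`θ = ½ log_{1+ε₀}(1 + P²/c₀²) > 1/2` iff `P² > ε₀c₀²`), `D = 1 + P²/c₀²`, at EVERY scale ratio `1 + ε₀ > 1`;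
* `deadEndPump_shellBarrierAt_smallRatio` — in particular for every `ε₀ ∈ (0, 1/4]` as soon as `P > c₀/2`: the first
  RECURRENT corner (a live chain at `b ≤ 5/4`) inside the registered stub `stub_primaryGradedSmallRatio`;
* `deadEndPump_ceilingAt` (`CeilingAt`, composes with the skeleton's `fwdCeilingKPAt_of_ceilingAt`) and
  `deadEndPump_primaryGraded` (the body of the skeleton's `PrimaryGradedAt`, verbatim, grading `lev ≡ 0`, via
  `kpPrimaryGraded_of_shellBarrierAt`) — the corner in the currencies of the composition and of BOTH registered stubs.

With `Theorems/SubOnsagerCeilingKPRelabel.lean` the corner holds at every placement of the two components.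
HONEST FRAMING: statements about Tao-type MODEL lattice ODEs (route SubOnsagerCeiling, rung TL-M2Break); one
architecture class (`P/c₀ > √ε₀`; the complementary window is the region rungs' / open); no stub, crux or summit is
proved and nothing here bears on Navier–Stokes regularity. [cite: Tao2016AveragedNS, §4 (4.2)–(4.3), (4.13)]
-/

noncomputable section

-- the sub-problem namespace `NavierStokesRegularity.NavierStokesRegularity` is the tree's layout (D-0017)
set_option linter.dupNamespace false

namespace Summit.NavierStokesRegularity.NavierStokesRegularity.Theorems

open Set Finset MeasureTheory intervalIntegral
open scoped Topology
open Literature.Analysis.FluidPDE.TaoCascade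
open Summit.NavierStokesRegularity.NavierStokesRegularity.Theorems.SubOnsagerCeiling

/-! ## The ν-uniform shell barrier of the dead-end pump class at every scale ratio -/

/-- **ENERGY STARVATION BARRIER.**  For every KP network proper `α ∈ E₂(R)` of the dead-end pump class (chain
weight `c₀ > 0` on component `0`, in-shell diagonal pump `P ≥ 0` into the dead-end component `1`, nothing else)
with `P² > ε₀·c₀²`, at EVERY scale ratio `1 + ε₀ > 1`: `ShellBarrierAt R ε₀ α` with
`(1+ε₀)^{2θ} = 1 + P²/c₀²` (so `θ = ½·log_{1+ε₀}(1 + P²/c₀²) > 1/2`) and `D = 1 + P²/c₀²` — along every honest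
non-negative `ν`-viscous solution from every one-shell datum, uniformly in `ν`,
`(1+ε₀)^{2θk}·½X_{i,k}(t)² ≤ (1 + P²/c₀²)·E₀` for all components `i`, shells `k` and times `t ∈ [0,s]`.
MODEL lattice statement; a corner of the registered stubs, not the stubs. [cite: Tao2016AveragedNS, §4 (4.13)] -/
theorem deadEndPump_shellBarrierAt {α : Fin 4 → Fin 4 → Fin 4 → ℤ × ℤ × ℤ → ℝ} {c₀ P ε₀ : ℝ}
    (hε : 0 < ε₀) (hc₀ : 0 < c₀) (hP0 : 0 ≤ P) (hgap : ε₀ * c₀ ^ 2 < P ^ 2)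
    (hD : ∀ a b i : Fin 4, a ≠ b → α a b i (0, 0, 1) = 0)
    (hw : ∀ a c : Fin 4, α a a c (0, 0, 1) = if a = 0 ∧ c = 0 then c₀ else 0)
    (hP : ∀ a c : Fin 4, a ≠ c → α a a c (0, 0, 0) = if a = 0 ∧ c = 1 then P else 0)
    (hCz : ∀ a b c : Fin 4, a ≠ b → a ≠ c → b ≠ c → α a b c (0, 0, 0) = 0) (R : ℝ) :
    ShellBarrierAt R ε₀ α := by
  intro hT hO
  have hs : IsSymmetricCoeff α := hT.1
  have hc : IsCancellingCoeff α := hT.2.1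
  set r : ℝ := P ^ 2 / c₀ ^ 2 with hr
  have hr0 : 0 < 1 + r := by positivity
  have hb1 : (1 : ℝ) < 1 + ε₀ := by linarith
  have hb0 : (0 : ℝ) < 1 + ε₀ := by linarith
  have hrb : 1 + ε₀ < 1 + r := by
    have : ε₀ < P ^ 2 / c₀ ^ 2 := by
      rw [lt_div_iff₀ (by positivity)]
      exact hgap
    simp only [hr]
    linarith
  set θ : ℝ := Real.logb (1 + ε₀) (1 + r) / 2 with hθ
  have hθhalf : 1 / 2 < θ := by
    have : 1 < Real.logb (1 + ε₀) (1 + r) := by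
      rw [Real.lt_logb_iff_rpow_lt hb1 hr0, Real.rpow_one]
      exact hrb
    simp only [hθ]
    linarith
  have hpow : (1 + ε₀) ^ (2 * θ) = 1 + r := by
    have : 2 * θ = Real.logb (1 + ε₀) (1 + r) := by simp only [hθ]; ring
    rw [this, Real.rpow_logb hb0 hb1.ne' hr0]
  refine ⟨θ, hθhalf, 1 + r, hr0.le, ?_⟩
  intro ν hν X₀ s _hs X hX0 hXneg _hM hXc hXd hXpos t ht i k
  set E₀ : ℝ := ∑ j : Fin 4, (1 / 2 : ℝ) * X₀ j ^ 2 with hE₀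
  have hE₀0 : 0 ≤ E₀ := Finset.sum_nonneg fun j _ => by positivity
  -- the shell sums are starved geometrically: `Σ_i ½X_{i,k}(t)² ≤ E₀ (1+r) (1+r)^{-k}`
  have hshell : ∑ j : Fin 4, (1 / 2 : ℝ) * X j (k : ℤ) t ^ 2 ≤ E₀ * (1 + r) * ((1 + r)⁻¹) ^ k := by
    cases k with
    | zero =>
      have h := kpProper_lowEnergy_le hs hc hO hD hb0 hν.le hX0 hXneg hXc hXd hXpos 0 t ht
      rw [Finset.range_one, Finset.sum_singleton] at h
      have h1 : E₀ ≤ E₀ * (1 + r) * ((1 + r)⁻¹) ^ 0 := by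
        rw [pow_zero, mul_one]
        nlinarith
      exact h.trans h1
    | succ m =>
      have hband := kpProper_bandEnergy_le_gateFlux hs hc hO hD hb0 hν.le hX0 hXneg hXc hXd hXpos
        (m := m) (N := m + 1) (by omega) t ht
      rw [Finset.Icc_self, Finset.sum_singleton] at hband
      simp only [deadEndPump_gateFlux hw] at hband
      have hflux := deadEndPump_flux_le hs hc hO hD hw hP hCz hε.le hν.le hc₀ hP0 hX0 hXneg hXc hXd hXpos m t ht
      have heq : E₀ * ((1 + r)⁻¹) ^ m = E₀ * (1 + r) * ((1 + r)⁻¹) ^ (m + 1) := by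
        rw [pow_succ]
        field_simp
      calc ∑ j : Fin 4, (1 / 2 : ℝ) * X j ((m + 1 : ℕ) : ℤ) t ^ 2 ≤ _ := hband
        _ ≤ E₀ * ((1 + r)⁻¹) ^ m := hflux
        _ = _ := heq
  have hsingle : (1 / 2 : ℝ) * X i (k : ℤ) t ^ 2 ≤ ∑ j : Fin 4, (1 / 2 : ℝ) * X j (k : ℤ) t ^ 2 :=
    Finset.single_le_sum (f := fun j => (1 / 2 : ℝ) * X j (k : ℤ) t ^ 2) (fun j _ => by positivity)
      (Finset.mem_univ i)
  have hweight : (1 + ε₀) ^ (2 * θ * (k : ℝ)) = (1 + r) ^ k := by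
    rw [Real.rpow_mul hb0.le, hpow, Real.rpow_natCast]
  rw [hweight]
  calc (1 + r) ^ k * ((1 / 2 : ℝ) * X i (k : ℤ) t ^ 2) ≤ (1 + r) ^ k * (E₀ * (1 + r) * ((1 + r)⁻¹) ^ k) :=
        mul_le_mul_of_nonneg_left (hsingle.trans hshell) (pow_nonneg hr0.le k)
    _ = (1 + r) * E₀ := by
        rw [inv_pow]
        field_simp

/-- **The small-ratio regime**: for `ε₀ ∈ (0, 1/4]` every dead-end pump network with `P > c₀/2` obeys the
ν-uniform shell barrier — the first RECURRENT corner (a live Katz–Pavlović chain at scale ratios `b ≤ 5/4`) inside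
the registered stub `stub_primaryGradedSmallRatio`. MODEL lattice statement. [cite: Tao2016AveragedNS, §4 (4.13)] -/
theorem deadEndPump_shellBarrierAt_smallRatio {α : Fin 4 → Fin 4 → Fin 4 → ℤ × ℤ × ℤ → ℝ} {c₀ P ε₀ : ℝ}
    (hε : 0 < ε₀) (hε4 : ε₀ ≤ 1 / 4) (hc₀ : 0 < c₀) (hPc : c₀ / 2 < P)
    (hD : ∀ a b i : Fin 4, a ≠ b → α a b i (0, 0, 1) = 0)
    (hw : ∀ a c : Fin 4, α a a c (0, 0, 1) = if a = 0 ∧ c = 0 then c₀ else 0)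
    (hP : ∀ a c : Fin 4, a ≠ c → α a a c (0, 0, 0) = if a = 0 ∧ c = 1 then P else 0)
    (hCz : ∀ a b c : Fin 4, a ≠ b → a ≠ c → b ≠ c → α a b c (0, 0, 0) = 0) (R : ℝ) :
    ShellBarrierAt R ε₀ α := by
  have hP0 : 0 ≤ P := by linarith
  refine deadEndPump_shellBarrierAt hε hc₀ hP0 ?_ hD hw hP hCz R
  nlinarith [mul_le_mul_of_nonneg_right hε4 (sq_nonneg c₀)]

/-- **Tail ceiling** for the dead-end pump class with `P² > ε₀c₀²` (`CeilingAt R ε₀ α`, by the landed glue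
`subOnsagerCeiling_ceilingAt_of_shellBarrierAt`); composes with the LEAD skeleton's `fwdCeilingKPAt_of_ceilingAt`.
MODEL lattice statement. [cite: Tao2016AveragedNS, §4 (4.13)] -/
theorem deadEndPump_ceilingAt {α : Fin 4 → Fin 4 → Fin 4 → ℤ × ℤ × ℤ → ℝ} {c₀ P ε₀ : ℝ}
    (hε : 0 < ε₀) (hc₀ : 0 < c₀) (hP0 : 0 ≤ P) (hgap : ε₀ * c₀ ^ 2 < P ^ 2)
    (hD : ∀ a b i : Fin 4, a ≠ b → α a b i (0, 0, 1) = 0)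
    (hw : ∀ a c : Fin 4, α a a c (0, 0, 1) = if a = 0 ∧ c = 0 then c₀ else 0)
    (hP : ∀ a c : Fin 4, a ≠ c → α a a c (0, 0, 0) = if a = 0 ∧ c = 1 then P else 0)
    (hCz : ∀ a b c : Fin 4, a ≠ b → a ≠ c → b ≠ c → α a b c (0, 0, 0) = 0) (R : ℝ) :
    CeilingAt R ε₀ α :=
  subOnsagerCeiling_ceilingAt_of_shellBarrierAt hε (deadEndPump_shellBarrierAt hε hc₀ hP0 hgap hD hw hP hCz R)

/-- **The registered stubs' currency**: the body of the skeleton's `PrimaryGradedAt R ε₀ α` (verbatim) for every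
dead-end pump network with `P² > ε₀c₀²`, at every scale ratio (grading `lev ≡ 0`, by
`kpPrimaryGraded_of_shellBarrierAt`). MODEL lattice statement; a corner of `stub_primaryGradedLargeRatio` AND of
`stub_primaryGradedSmallRatio`, not the stubs. [cite: Tao2016AveragedNS, §4 (4.13)] -/
theorem deadEndPump_primaryGraded {α : Fin 4 → Fin 4 → Fin 4 → ℤ × ℤ × ℤ → ℝ} {c₀ P ε₀ : ℝ}
    (hε : 0 < ε₀) (hc₀ : 0 < c₀) (hP0 : 0 ≤ P) (hgap : ε₀ * c₀ ^ 2 < P ^ 2)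
    (hD : ∀ a b i : Fin 4, a ≠ b → α a b i (0, 0, 1) = 0)
    (hw : ∀ a c : Fin 4, α a a c (0, 0, 1) = if a = 0 ∧ c = 0 then c₀ else 0)
    (hP : ∀ a c : Fin 4, a ≠ c → α a a c (0, 0, 0) = if a = 0 ∧ c = 1 then P else 0)
    (hCz : ∀ a b c : Fin 4, a ≠ b → a ≠ c → b ≠ c → α a b c (0, 0, 0) = 0) (R : ℝ) :
    Literature.Analysis.FluidPDE.TaoCascade.InTableClass R α →
      (∀ (Y : Fin 4 → ℤ → ℝ → ℝ) (τ : ℝ), (∀ (j : Fin 4) (k : ℤ), 1 ≤ k → 0 ≤ Y j k τ) → ∀ δ : ℝ, 0 < δ →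
        ∀ (i : Fin 4) (n : ℤ), 1 ≤ n → Y i n τ = 0 → 0 ≤ Literature.Analysis.FluidPDE.TaoCascade.quadTerm δ α Y i n τ) →
      (∀ a b i : Fin 4, a ≠ b → α a b i (0, 0, 1) = 0) →
      ∃ (lev : Fin 4 → ℕ) (L : ℕ), (∀ a, lev a ≤ L) ∧
        (∀ a, lev a ≠ 0 → (∃ e, α a a e (0, 0, 1) ≠ 0) →
          (∀ j, α j j a (0, 0, 1) ≠ 0 → lev j < lev a ∧ (lev j = 0 ∨ ∃ e', α j j e' (0, 0, 1) ≠ 0)) ∧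
          (∀ i₁ i₂, i₁ ≠ a → i₂ ≠ a → α i₁ i₂ a (0, 0, 0) ≠ 0 →
            (lev i₁ < lev a ∧ (lev i₁ = 0 ∨ ∃ e', α i₁ i₁ e' (0, 0, 1) ≠ 0)) ∧
            (lev i₂ < lev a ∧ (lev i₂ = 0 ∨ ∃ e', α i₂ i₂ e' (0, 0, 1) ≠ 0))) ∧
          (∃ e, α a a e (0, 0, 1) ≠ 0 ∧
            (∀ j, α e e j (0, 0, 1) ≠ 0 → lev j < lev a ∧ (lev j = 0 ∨ ∃ e', α j j e' (0, 0, 1) ≠ 0)) ∧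
            (∀ j, j ≠ e → α e e j (0, 0, 0) ≠ 0 →
              lev j < lev a ∧ (lev j = 0 ∨ ∃ e', α j j e' (0, 0, 1) ≠ 0)))) ∧
        ∃ θ : ℝ, 1 / 2 < θ ∧ θ ≤ 1 ∧ ∃ D : ℝ, 0 ≤ D ∧
          ∀ ν : ℝ, 0 < ν → ∀ (X₀ : Fin 4 → ℝ) (s : ℝ), 0 < s → ∀ X : Fin 4 → ℤ → ℝ → ℝ,
          (∀ (i : Fin 4) (k : ℤ), X i k 0 = if k = 0 then X₀ i else 0) →
          (∀ (i : Fin 4) (k : ℤ), k < 0 → ∀ t : ℝ, X i k t = 0) →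
          (∃ M : ℝ, ∀ (t : ℝ) (i : Fin 4) (k : ℤ), (1 + (1 + ε₀) ^ ((10 : ℝ) * k)) * |X i k t| ≤ M) →
          (∀ (i : Fin 4) (k : ℤ), Continuous (X i k)) →
          (∀ (i : Fin 4) (k : ℤ), ∀ t ∈ Set.Icc (0 : ℝ) s, HasDerivWithinAt (X i k)
            (Literature.Analysis.FluidPDE.TaoCascade.quadTerm ε₀ α X i k t - ν * (1 + ε₀) ^ ((2 : ℝ) * k) * X i k t)
            (Set.Icc (0 : ℝ) s) t) →
          (∀ t ∈ Set.Icc (0 : ℝ) s, ∀ (i : Fin 4) (k : ℤ), 1 ≤ k → 0 ≤ X i k t) →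
          ∀ t ∈ Set.Icc (0 : ℝ) s, ∀ i, lev i = 0 → ∀ k : ℕ,
            (1 + ε₀) ^ (2 * θ * (k : ℝ)) * ((1 / 2 : ℝ) * X i (k : ℤ) t ^ 2) ≤
              D * (∑ j : Fin 4, (1 / 2 : ℝ) * X₀ j ^ 2) :=
  kpPrimaryGraded_of_shellBarrierAt hε (deadEndPump_shellBarrierAt hε hc₀ hP0 hgap hD hw hP hCz R)

end Summit.NavierStokesRegularity.NavierStokesRegularity.Theorems

end
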